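import Summits.QuantumFields.YangMills.Theorems.BalabanUVNodesPortS1FHInterface
import Summits.QuantumFields.YangMills.Theorems.BalabanUVNodesK0RecordFormatNamesFluct

/-!
# NODE O port — F-vocabulary (c), part FH AT THE RECORD: the (w7) pin of the construction statement (C-FW) instantiated with `H₁ := recordH1`

Definition pen `pub-ymgap-node00-def-Y` (g41), docket ★★★ director-ym №652 (3); `--supports stmt-QuantumFields-27930 --as helper`; count-neutral.  Companion of the RECORD-FREE interface file
`BalabanUVNodesPortS1FHInterface.lean` (◇ lens-1 g17 v24∕v24.1 hoisted; ◆ CRIT-1 g40 (w6)(w7)); split off by the gate's 400-line budget for Theorems files with proofs.  THIS is the only file of the pair that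
reads the record.  [II] = [Balaban1988RG2Cluster], [13] = [Balaban1985BackgroundPropagators], [15] = [Balaban1985Variational].

WHAT THIS FILE TYPES: the complexification embeddings `fluctRealEmb F k K : (FluctIdx F k K → ℝ) →L[ℝ] (FluctIdx F k K → ℂ)` and `fineRealEmb F K : (FineIdx F K → ℝ) →L[ℝ] (FineIdx F K → ℂ)`
(componentwise `Complex.ofRealCLM`; sup norms — ◇'s simplification (s1)), their `@[simp]` apply lemmas, `fineRealEmb_injective`, and
**`ConstructionFWAtRecord F k K εbg Vk H H₀ G fam κ₁ B₀ := ConstructionFWPinned (fluctRealEmb F k K) (fineRealEmb F K) (recordH1 F k K εbg Vk) H H₀ G fam κ₁ B₀`** — the `H₀`-slot PINNED to the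
port's ✓`recordH1` (the linear part of `H_k`, [I] (2.20), the ONE port name that exists, v23 (c2)); `H`, `G`, their spaces `𝔛`, `𝔜`, the cube type `σ` and the family are BINDERS (no port names today,
v23 (c3)); `not_constructionFWAtRecord_zero` (the `H₀ = 0` discharge is impossible once `recordH1 … ≠ 0`) and the use-form `h0s_one_fluctRealEmb` (at `s = 1` the family member restricts on real
fields to `recordH1`), both PROVED (bookkeeping).

HONEST (■ RR-2 g32 READ 29 (6), kernel-checked `rr2_exists_constructionFWAtRecord`; ◆ CRIT-1 g40 CUT nodeO l.6327 (3)(k3)): `ConstructionFWAtRecord` — like `ConstructionFW`∕`ConstructionFWPinned` — is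
INHABITED OUTRIGHT by CONSTANT families with `B₀` a binder; the (w7) pin only removes the `H₀ = 0` discharge.  It is a SLOT, not a letter with content.  Content arrives with the NEXT interface
increment, NOT typed here: (C-FW-loc) KERNEL LOCALITY at `s(σᶜ) = 0` ([II] p.4 L19–22) — LOAD-BEARING (◆ (k3): only it excludes the constant families) — and (C-FW-unif) `B₀`, `κ₁` pinned to the
[13] (3.107)∕(3.108) constants (bookkeeping on top).  NO instance of 𝔅 at the record; nothing of [II] (1.2)–(1.18), [15] Sect. C∕E∕G, [13] (3.107)∕(3.108), Lemma 1 is proved or ported; F, S₃, `stub_P0C`,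
every P0-family letter OPEN; ⟨27930⟩ OPEN; NODE O 0∕1; COUNT 8∕28 · K 1∕4 UNMOVED; finite `𝕋⁴_{L^K}` at fixed ε — NOT continuum ∕ OS ∕ Clay; **the Yang–Mills mass gap is NOT proved by any of this.**
No `sorry`, no `instance`, no `notation`; standard axioms.
-/

noncomputable section

namespace Summit.QuantumFields.YangMills.Theorems.BalabanUVNodesPortS1.FHInterface

open Literature.MathematicalPhysics.QuantumFieldTheory.Balaban1983to89
open Literature.MathematicalPhysics.QuantumFieldTheory.Balaban1983to89.Node00
open Literature.MathematicalPhysics.QuantumFieldTheory.Balaban1983to89.T4Continuum (T4Family)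
open Summit.QuantumFields.YangMills.Theorems.K0RecordFormatNames

/-! ## §1  The complexification embeddings and the (w7) pin AT THE RECORD (`H₁ := recordH1`) -/

/-- The complexification embedding of REAL B′-fields `FluctIdx F k K → ℝ` into `FluctIdx F k K → ℂ` (componentwise `Complex.ofRealCLM`). [folklore] -/
def fluctRealEmb (F : T4Family) (k K : ℕ) : (FluctIdx F k K → ℝ) →L[ℝ] (FluctIdx F k K → ℂ) :=
  ContinuousLinearMap.pi fun i => Complex.ofRealCLM.comp (ContinuousLinearMap.proj i)

/-- The complexification embedding of REAL A-configurations in fine 𝔰𝔲(2)-coordinates `FineIdx F K → ℝ` into `FineIdx F K → ℂ`. [folklore] -/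
def fineRealEmb (F : T4Family) (K : ℕ) : (FineIdx F K → ℝ) →L[ℝ] (FineIdx F K → ℂ) :=
  ContinuousLinearMap.pi fun p => Complex.ofRealCLM.comp (ContinuousLinearMap.proj p)

/-- Componentwise reading of `fluctRealEmb`. [folklore] -/
@[simp] theorem fluctRealEmb_apply (F : T4Family) (k K : ℕ) (x : FluctIdx F k K → ℝ) (i : FluctIdx F k K) :
    fluctRealEmb F k K x i = (x i : ℂ) := rfl

/-- Componentwise reading of `fineRealEmb`. [folklore] -/
@[simp] theorem fineRealEmb_apply (F : T4Family) (K : ℕ) (y : FineIdx F K → ℝ) (p : FineIdx F K) :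
    fineRealEmb F K y p = (y p : ℂ) := rfl

/-- The fine complexification embedding is injective (so ◇'s anti-vacuity witness applies at the record). [folklore] -/
theorem fineRealEmb_injective (F : T4Family) (K : ℕ) : Function.Injective (fineRealEmb F K) := by
  intro y y' h
  funext p
  have := congrArg (fun z => z p) h
  simpa using this

/-- **(C-FW) AT THE RECORD** — ◇'s `ConstructionFWPinned` with the `H₀`-slot PINNED to the port's ✓`recordH1 F k K εbg Vk` (◆ CRIT-1 g40 (w7)): «there are operators
`H : 𝔛 → 𝔄`, `G : 𝔜 → 𝔄` and s-decoupled families of `H, H₀, G` satisfying (1.11) and coinciding with them at `s = 1`, where `𝔄 := FineIdx F K → ℂ`, `𝔅 := FluctIdx F k K → ℂ`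
and `H₀ ∘ ι_B = ι_A ∘ recordH1`».  `H`, `G`, their spaces, the cube type `σ` of the partition σ₀ and the family are BINDERS — the port has no names for the propagators `H`, `G` nor
for the decoupled families today (v23 R1 (c3)); their pins are added when the [13]∕[B9] lanes name them.  **HONEST (■ RR-2 g32 READ 29 (6), kernel-checked
`rr2_exists_constructionFWAtRecord`): AS TYPED THIS LETTER IS INHABITED OUTRIGHT** — `H₀ :=` the complexification of `recordH1`, CONSTANT families `s ↦ (H, H₀, G)` (entire, bounded), `B₀ := ` their norm
— so it carries NO analytic content yet: ALL components are dischargeable, not only `H`∕`G`.  What print's families have and this slot does not (the NEXT interface increment, record-free field +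
record instantiation; not typed in this file): (C-FW-loc) KERNEL LOCALITY AT `s(σᶜ) = 0` — [II] p.4 L19–22 «kernels of the operators H(s), G(s), H₀(s) vanish, unless both arguments are in the
interior of one component of Y(σ), in fact with distances to the boundary of this component bigger than M₁» (needs the site maps of the coordinate types and the component structure of
`Y(σ) = □₄ ∪ ⋃_{□∈σ} □`), and (C-FW-unif) `B₀`, `κ₁` PINNED to the [13] (3.107)∕(3.108) constants uniformly in `k, K` (here they are binders).  This def is the SLOT those lanes refine —
a bookkeeping target, not a statement with content; OPEN in print's sense, trivially inhabited in Lean's. [cite: Balaban1988RG2Cluster, (1.2) p.2, (1.6)–(1.7) p.3, p.3 L20–30, (1.11) p.5; Balaban1985BackgroundPropagators, (3.107)–(3.108) p.416;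
Balaban1985Variational, (103) p.293] -/
def ConstructionFWAtRecord (F : T4Family) (k K : ℕ) (εbg : ℝ) (Vk : GaugeField (F.P K) k (SU 2))
    {𝔛 𝔜 : Type*} [NormedAddCommGroup 𝔛] [NormedSpace ℂ 𝔛] [NormedAddCommGroup 𝔜] [NormedSpace ℂ 𝔜] {σ : Type*} [Fintype σ]
    (H : 𝔛 →L[ℂ] (FineIdx F K → ℂ)) (H₀ : (FluctIdx F k K → ℂ) →L[ℂ] (FineIdx F K → ℂ)) (G : 𝔜 →L[ℂ] (FineIdx F K → ℂ))
    (fam : DecoupledOps (FineIdx F K → ℂ) 𝔛 (FluctIdx F k K → ℂ) 𝔜 σ) (κ₁ B₀ : ℝ) : Prop :=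
  ConstructionFWPinned (fluctRealEmb F k K) (fineRealEmb F K) (recordH1 F k K εbg Vk) H H₀ G fam κ₁ B₀

/-- **Anti-vacuity at the record** (◇'s `not_constructionFWPinned_zero` instantiated): once `recordH1 … ≠ 0`, the construction statement at the record is NOT satisfied with `H₀ = 0`.
[cite: Balaban1988RG2Cluster, (1.11) p.5 (bookkeeping witness)] -/
theorem not_constructionFWAtRecord_zero (F : T4Family) {k K : ℕ} {εbg : ℝ} {Vk : GaugeField (F.P K) k (SU 2)} (hH₁ : recordH1 F k K εbg Vk ≠ 0)
    {𝔛 𝔜 : Type*} [NormedAddCommGroup 𝔛] [NormedSpace ℂ 𝔛] [NormedAddCommGroup 𝔜] [NormedSpace ℂ 𝔜] {σ : Type*} [Fintype σ]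
    (H : 𝔛 →L[ℂ] (FineIdx F K → ℂ)) (G : 𝔜 →L[ℂ] (FineIdx F K → ℂ)) (fam : DecoupledOps (FineIdx F K → ℂ) 𝔛 (FluctIdx F k K → ℂ) 𝔜 σ) (κ₁ B₀ : ℝ) :
    ¬ ConstructionFWAtRecord F k K εbg Vk H 0 G fam κ₁ B₀ :=
  not_constructionFWPinned_zero (fluctRealEmb F k K) (fineRealEmb_injective F K) hH₁ H G fam κ₁ B₀

/-- Use-form of the pin: under (C-FW) at the record, the family member at `s = 1` restricts on real fields to ✓`recordH1` (bookkeeping). [cite: Balaban1988RG2Cluster, p.3 L29–30 (bookkeeping)] -/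
theorem h0s_one_fluctRealEmb (F : T4Family) {k K : ℕ} {εbg : ℝ} {Vk : GaugeField (F.P K) k (SU 2)}
    {𝔛 𝔜 : Type*} [NormedAddCommGroup 𝔛] [NormedSpace ℂ 𝔛] [NormedAddCommGroup 𝔜] [NormedSpace ℂ 𝔜] {σ : Type*} [Fintype σ]
    {H : 𝔛 →L[ℂ] (FineIdx F K → ℂ)} {H₀ : (FluctIdx F k K → ℂ) →L[ℂ] (FineIdx F K → ℂ)} {G : 𝔜 →L[ℂ] (FineIdx F K → ℂ)}
    {fam : DecoupledOps (FineIdx F K → ℂ) 𝔛 (FluctIdx F k K → ℂ) 𝔜 σ} {κ₁ B₀ : ℝ}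
    (h : ConstructionFWAtRecord F k K εbg Vk H H₀ G fam κ₁ B₀) (x : FluctIdx F k K → ℝ) :
    fam.H₀s 1 (fluctRealEmb F k K x) = fineRealEmb F K (recordH1 F k K εbg Vk x) := by
  obtain ⟨hpin, -, hH₀, -, -⟩ := h
  rw [hH₀]
  exact hpin x

end Summit.QuantumFields.YangMills.Theorems.BalabanUVNodesPortS1.FHInterface
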